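import Mathlib.Analysis.PSeries
import Mathlib.Analysis.SpecialFunctions.Trigonometric.Bounds
import Literature.NumberTheory.LFunctions.GaussianHeckeMeanValue
import HarnessLib

/-!
# The mean value theorem for Hecke polynomials of `ℤ[i]` (dual large sieve for `ℤ[i]`) — proof

This file DISCHARGES the named fact `JarviniemiTeravainen2024_heckeMVT` of
`Literature/NumberTheory/LFunctions/GaussianHeckeMeanValue.lean`
(Järviniemi–Teräväinen 2024, Lemma 3.2, first display = Harman 2007, Lemma 11.1, "a dual form of
the large sieve for `ℤ[i]`", over `|m| ≤ T`):
`theorem JarviniemiTeravainen2024_heckeMVT_holds : JarviniemiTeravainen2024_heckeMVT`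
(with `C = 24 (1 + 2π²)`; the sources only assert `≪`).

The sibling `GaussianHeckeMeanValueProofs.lean` discharges the OTHER fact of that file, the
improved mean value theorem `JarviniemiTeravainen2024_heckeIMVT` (JT Lemma 3.3), by a Fejér
majorant in `m` and a cell/Schur argument in `arg n`; the present file is independent of it (it
imports only the statement file): Lemma 3.2 needs the regrouping along rays and the angular
SPACING of primitive points, which Lemma 3.3 does not see, and we phrase the whole argument with
chordal distances on the unit circle, which removes the bookkeeping of `arg` modulo `π/2`.

## Source followed

JT prove Lemma 3.2 by "See [Harman]"; Harman proves Lemma 11.1 in §A.3 (PDF pp. 291–292 =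
book pp. 345–346, "stated as Lemma 6 in [24]" = Coleman). We follow Harman's §A.3 argument step
by step:

1. *Regroup along rays* (`heckeSum_eq_sum_primitive`): `∑_{N(n) ≤ N} c(n) λ^m(n)
   = ∑'_{n primitive} c₁(n) λ^m(n)`, `c₁ = ` the ray sums `rayCoeff` — because `λ^m` only
   depends on `arg n` and every `n ∈ ℤ[i]*` is `k · p` with `p` primitive on the same ray.
2. *Spacing* ("the reader can quickly verify that `N⁻¹ ≫ δ ≫ N⁻¹`", made explicit in
   `norm_unit4_sub_unit4_ge`): for distinct primitive `p, q` with `N(p), N(q) ≤ N` the points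
   `u(p) = (p/|p|)^4 = e^{4 i arg p}` of the unit circle have chordal distance `≥ 2/N`, via the
   identity `|(Z/|Z|)^4 - 1| = 4 |re Z| |im Z| / |Z|²` at `Z = p q̄ ∈ ℤ[i]` (`re Z ≥ 1`, `im Z ≠ 0`).
3. *Fejér weights in `m`* (`fejer_majorant`): Harman inserts `θ(m) = 1 - |m|/2T` on `[-2T, 2T]`;
   we use the equivalent combinatorial majorant `(T + 1) · 1_{[-T, T]}(m) ≤ #{(j, k) ∈ [0, 3T]² :
   j - k = m}`, whose kernel after multiplying out is `|∑_{j ≤ 3T} w^j|²` — this avoids the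
   closed form `(sin (2πTx) / sin (πx))² / 2T` and all trigonometric bookkeeping.
4. *Multiply out and use `|c c'| ≤ (|c|² + |c'|²)/2`* ("a familiar technique"):
   `dual_large_sieve_circle`, steps `h4`, `h5`.
5. *Kernel bound* `|∑_{j<L} w^j|² ≤ min (L², 4/|w - 1|²)` (`norm_geom_sum_le`) — Harman's
   `≪ (1/T) min (T², ‖x‖⁻²)` up to the normalisation by `T + 1`.
6. *"The reader should now be able to complete the proof"*: the sum of the kernel over
   `δ`-spaced points is `≪ L² + L/δ` (`sum_le_of_separated`, by the packing bound
   `card_le_of_separated`: `δ`-separated reals in an interval of length `ℓ` number `≤ ℓ/δ + 1`),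
   giving `∑_{|m| ≤ T} |∑_p b_p u_p^m|² ≤ 24 (1 + 2π²) (T + δ⁻¹) ∑_p |b_p|²`
   (`dual_large_sieve_circle`), and with `δ = 2/N` the fact with `C = 24 (1 + 2π²)`.

Sharper dual large sieves with mod-1 spacing already exist in the tree
(`Literature.NumberTheory.Sieve.ParityWave0LargeSieveProofs.largeSieve_dual`, constant
`N + δ⁻¹ + 3/2`, after Montgomery–Vaughan); we keep Harman's elementary route here, phrased with
chordal distances on the circle (no `arg` modulo `π/2` bookkeeping) and import-light.

## References

* G. Harman, *Prime-Detecting Sieves*, LMS Monographs 33 (2007), Lemma 11.1 (PDF p. 205)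
  and §A.3 (PDF pp. 291–292 of the held copy) [Harman2007].
* O. Järviniemi, J. Teräväinen, *Gaussian almost primes in almost all narrow sectors*,
  Rev. Mat. Iberoam. 40 (2024), Lemma 3.2 [JarviniemiTeravainen2024].
-/

noncomputable section

open Complex Finset
open scoped Real ComplexConjugate

namespace Literature.NumberTheory.LFunctions.GaussianInt

namespace HeckeMVT


/-! #### Packing of separated points on a line -/

/-- `δ`-separated values in `[lo, hi]`: at most `(hi - lo)/δ + 1` of them (induction on the
maximum). [folklore] -/
theorem card_le_of_separated {ι : Type*} [DecidableEq ι] (α : ι → ℝ) {δ : ℝ} (hδ : 0 < δ)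
    (lo : ℝ) (B : Finset ι) :
    (∀ q ∈ B, ∀ q' ∈ B, q ≠ q' → δ ≤ |α q - α q'|) → (∀ q ∈ B, lo ≤ α q) →
      ∀ hi : ℝ, (∀ q ∈ B, α q ≤ hi) → lo ≤ hi → (B.card : ℝ) ≤ (hi - lo) / δ + 1 := by
  refine Finset.induction_on_max_value (motive := fun B : Finset ι =>
    (∀ q ∈ B, ∀ q' ∈ B, q ≠ q' → δ ≤ |α q - α q'|) → (∀ q ∈ B, lo ≤ α q) →
      ∀ hi : ℝ, (∀ q ∈ B, α q ≤ hi) → lo ≤ hi → (B.card : ℝ) ≤ (hi - lo) / δ + 1) α B ?_ ?_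
  · intro _ _ hi _ hlh
    simp only [card_empty, Nat.cast_zero]
    have : 0 ≤ (hi - lo) / δ := div_nonneg (by linarith) hδ.le
    linarith
  · intro a s ha hmax ih hsep hlo hi hhi hlh
    have hsep_s : ∀ q ∈ s, ∀ q' ∈ s, q ≠ q' → δ ≤ |α q - α q'| := fun q hq q' hq' hne =>
      hsep q (mem_insert_of_mem hq) q' (mem_insert_of_mem hq') hne
    have hlo_s : ∀ q ∈ s, lo ≤ α q := fun q hq => hlo q (mem_insert_of_mem hq)
    have ha_hi : α a ≤ hi := hhi a (mem_insert_self a s)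
    have hup : ∀ q ∈ s, α q ≤ α a - δ := by
      intro q hq
      have hne : q ≠ a := fun h => ha (h ▸ hq)
      have h1 := hsep q (mem_insert_of_mem hq) a (mem_insert_self a s) hne
      have h2 := hmax q hq
      have : |α q - α a| = α a - α q := by
        rw [abs_sub_comm]; exact abs_of_nonneg (by linarith)
      linarith
    rw [card_insert_of_notMem ha]
    push_cast
    rcases s.eq_empty_or_nonempty with hs | ⟨q₀, hq₀⟩
    · subst hs
      simp only [card_empty, Nat.cast_zero, zero_add]
      have : 0 ≤ (hi - lo) / δ := div_nonneg (by linarith) hδ.le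
      linarith
    · have hlh' : lo ≤ α a - δ := le_trans (hlo_s q₀ hq₀) (hup q₀ hq₀)
      have hih := ih hsep_s hlo_s (α a - δ) hup hlh'
      have hcalc : (α a - δ - lo) / δ + 1 = (α a - lo) / δ := by
        field_simp
        ring
      calc (s.card : ℝ) + 1 ≤ (α a - δ - lo) / δ + 1 + 1 := by linarith
        _ = (α a - lo) / δ + 1 := by rw [hcalc]
        _ ≤ (hi - lo) / δ + 1 := by gcongr

/-! #### The row sums over separated points -/

/-- For `δ`-separated reals `α_q` and weights `G q ≤ min (L², c/α_q²)`:
`∑_q G q ≤ 2 (1 + 2c) (L² + L/δ)` (decompose by `k = ⌊L |α_q|⌋`, at most `2 (1/(Lδ) + 1)`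
points per `k`, weights `≤ L²` for `k = 0` and `≤ c L²/k²` for `k ≥ 1`). [folklore] -/
theorem sum_le_of_separated {ι : Type*} [DecidableEq ι] (A : Finset ι) (α : ι → ℝ) {δ : ℝ}
    (hδ : 0 < δ) (hsep : ∀ q ∈ A, ∀ q' ∈ A, q ≠ q' → δ ≤ |α q - α q'|) {L : ℕ} (hL : 1 ≤ L)
    {c : ℝ} (hc : 0 ≤ c) (G : ι → ℝ) (hG1 : ∀ q ∈ A, G q ≤ (L : ℝ) ^ 2)
    (hG2 : ∀ q ∈ A, α q ≠ 0 → G q ≤ c / (α q) ^ 2) :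
    ∑ q ∈ A, G q ≤ 2 * (1 + 2 * c) * ((L : ℝ) ^ 2 + L / δ) := by
  set f : ι → ℕ := fun q => ⌊(L : ℝ) * |α q|⌋₊ with hf
  set t : Finset ℕ := A.image f with ht
  have hmaps : ∀ q ∈ A, f q ∈ t := fun q hq => mem_image_of_mem f hq
  rw [← Finset.sum_fiberwise_of_maps_to hmaps]
  set h : ℕ → ℝ := fun k => if k = 0 then 1 else c / (k : ℝ) ^ 2 with hh
  have hh0 : ∀ k, 0 ≤ h k := by
    intro k
    simp only [hh]
    split_ifs
    · exact zero_le_one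
    · positivity
  set cnt : ℝ := 2 * (1 / ((L : ℝ) * δ) + 1) with hcnt
  have hLpos : (0 : ℝ) < L := by exact_mod_cast hL
  -- the range of `α` on the fibre of `k`
  have hrange : ∀ k, ∀ q ∈ A.filter (fun q => f q = k),
      (k : ℝ) / L ≤ |α q| ∧ |α q| ≤ ((k : ℝ) + 1) / L := by
    intro k q hq
    rw [mem_filter] at hq
    obtain ⟨-, hfq⟩ := hq
    have h0 : 0 ≤ (L : ℝ) * |α q| := mul_nonneg hLpos.le (abs_nonneg _)
    have h1 : (k : ℝ) ≤ L * |α q| := by rw [← hfq]; exact Nat.floor_le h0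
    have h2 : (L : ℝ) * |α q| < k + 1 := by rw [← hfq]; exact Nat.lt_floor_add_one _
    constructor
    · rw [div_le_iff₀ hLpos]; linarith
    · rw [le_div_iff₀ hLpos]; linarith
  -- each term of the fibre of `k` is at most `L² h k`
  have hterm : ∀ k, ∀ q ∈ A.filter (fun q => f q = k), G q ≤ (L : ℝ) ^ 2 * h k := by
    intro k q hq
    have hr := hrange k q hq
    rw [mem_filter] at hq
    by_cases hk : k = 0
    · simp only [hh, hk, if_true, mul_one]
      exact hG1 q hq.1
    · simp only [hh, hk, if_false]
      have hk1 : (1 : ℝ) ≤ k := by exact_mod_cast Nat.one_le_iff_ne_zero.mpr hk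
      have hαpos : 0 < |α q| := by
        have : (0 : ℝ) < (k : ℝ) / L := by positivity
        linarith [hr.1]
      have hα0 : α q ≠ 0 := abs_pos.mp hαpos
      have hk2 : (k : ℝ) ^ 2 ≤ (L : ℝ) ^ 2 * (α q) ^ 2 := by
        have hkL : (k : ℝ) ≤ L * |α q| := by
          have := hr.1; rwa [div_le_iff₀ hLpos, mul_comm] at this
        calc (k : ℝ) ^ 2 ≤ ((L : ℝ) * |α q|) ^ 2 := by gcongr
          _ = (L : ℝ) ^ 2 * (α q) ^ 2 := by rw [mul_pow, sq_abs]
      have hkpos : (0 : ℝ) < (k : ℝ) ^ 2 := by positivity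
      have hαsq : (0 : ℝ) < (α q) ^ 2 := by positivity
      calc G q ≤ c / (α q) ^ 2 := hG2 q hq.1 hα0
        _ ≤ (L : ℝ) ^ 2 * c / (k : ℝ) ^ 2 := by
            rw [div_le_div_iff₀ hαsq hkpos]
            calc c * (k : ℝ) ^ 2 ≤ c * ((L : ℝ) ^ 2 * (α q) ^ 2) :=
                  mul_le_mul_of_nonneg_left hk2 hc
              _ = (L : ℝ) ^ 2 * c * (α q) ^ 2 := by ring
        _ = (L : ℝ) ^ 2 * (c / (k : ℝ) ^ 2) := by ring
  -- each fibre has at most `cnt` elements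
  have hcount : ∀ k, ((A.filter (fun q => f q = k)).card : ℝ) ≤ cnt := by
    intro k
    set B := A.filter (fun q => f q = k) with hB
    have hsepB : ∀ q ∈ B, ∀ q' ∈ B, q ≠ q' → δ ≤ |α q - α q'| := fun q hq q' hq' hne =>
      hsep q (mem_filter.1 hq).1 q' (mem_filter.1 hq').1 hne
    set Bp := B.filter (fun q => 0 ≤ α q) with hBp
    set Bm := B.filter (fun q => ¬ 0 ≤ α q) with hBm
    have hsplit : B.card = Bp.card + Bm.card :=
      (card_filter_add_card_filter_not (s := B) (fun q => 0 ≤ α q)).symm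
    have hone : ((k : ℝ) + 1) / L - k / L = 1 / L := by
      field_simp
      ring
    have hone' : -((k : ℝ) / L) - -(((k : ℝ) + 1) / L) = 1 / L := by
      field_simp
      ring
    have hBp_le : (Bp.card : ℝ) ≤ (1 / L) / δ + 1 := by
      have h := card_le_of_separated α hδ ((k : ℝ) / L) Bp
        (fun q hq q' hq' hne => hsepB q (mem_filter.1 hq).1 q' (mem_filter.1 hq').1 hne)
        (fun q hq => by
          have hq' := mem_filter.1 hq
          have := (hrange k q hq'.1).1
          rwa [abs_of_nonneg hq'.2] at this)
        (((k : ℝ) + 1) / L)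
        (fun q hq => by
          have hq' := mem_filter.1 hq
          have := (hrange k q hq'.1).2
          rwa [abs_of_nonneg hq'.2] at this)
        (by rw [div_le_div_iff_of_pos_right hLpos]; linarith)
      rwa [hone] at h
    have hBm_le : (Bm.card : ℝ) ≤ (1 / L) / δ + 1 := by
      have h := card_le_of_separated α hδ (-(((k : ℝ) + 1) / L)) Bm
        (fun q hq q' hq' hne => hsepB q (mem_filter.1 hq).1 q' (mem_filter.1 hq').1 hne)
        (fun q hq => by
          have hq' := mem_filter.1 hq
          have hneg : α q < 0 := lt_of_not_ge hq'.2
          have := (hrange k q hq'.1).2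
          rw [abs_of_neg hneg] at this
          linarith)
        (-((k : ℝ) / L))
        (fun q hq => by
          have hq' := mem_filter.1 hq
          have hneg : α q < 0 := lt_of_not_ge hq'.2
          have := (hrange k q hq'.1).1
          rw [abs_of_neg hneg] at this
          linarith)
        (by
          have : (k : ℝ) / L ≤ ((k : ℝ) + 1) / L := by
            rw [div_le_div_iff_of_pos_right hLpos]; linarith
          linarith)
      rwa [hone'] at h
    calc (B.card : ℝ) = Bp.card + Bm.card := by rw [hsplit]; push_cast; ring
      _ ≤ ((1 / L) / δ + 1) + ((1 / L) / δ + 1) := add_le_add hBp_le hBm_le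
      _ = cnt := by rw [hcnt, div_div]; ring
  -- the fibre sums
  have hfib : ∀ k ∈ t, ∑ q ∈ A.filter (fun q => f q = k), G q ≤ cnt * ((L : ℝ) ^ 2 * h k) := by
    intro k _
    have hLh : 0 ≤ (L : ℝ) ^ 2 * h k := mul_nonneg (sq_nonneg _) (hh0 k)
    calc ∑ q ∈ A.filter (fun q => f q = k), G q
        ≤ ∑ q ∈ A.filter (fun q => f q = k), (L : ℝ) ^ 2 * h k :=
          sum_le_sum fun q hq => hterm k q hq
      _ = ((A.filter (fun q => f q = k)).card : ℝ) * ((L : ℝ) ^ 2 * h k) := by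
          rw [sum_const, nsmul_eq_mul]
      _ ≤ cnt * ((L : ℝ) ^ 2 * h k) := by gcongr; exact hcount k
  -- the sum of the weights `h k`
  have hsumh : ∑ k ∈ t, h k ≤ 1 + 2 * c := by
    set M := t.sup id with hM
    have hsub : t ⊆ Ico 0 (M + 1) := by
      intro k hk
      rw [mem_Ico]
      exact ⟨Nat.zero_le _, Nat.lt_succ_of_le (le_sup (f := id) hk)⟩
    calc ∑ k ∈ t, h k ≤ ∑ k ∈ Ico 0 (M + 1), h k :=
          sum_le_sum_of_subset_of_nonneg hsub fun k _ _ => hh0 k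
      _ = h 0 + ∑ k ∈ Ioo 0 (M + 1), h k := by
          rw [← Finset.Ioo_insert_left (Nat.succ_pos M), sum_insert (by simp)]
      _ = 1 + c * ∑ k ∈ Ioo 0 (M + 1), ((k : ℝ) ^ 2)⁻¹ := by
          simp only [hh, if_true, mul_sum]
          congr 1
          refine sum_congr rfl fun k hk => ?_
          rw [mem_Ioo] at hk
          rw [if_neg (by omega), div_eq_mul_inv]
      _ ≤ 1 + c * 2 := by
          gcongr
          have := sum_Ioo_inv_sq_le (α := ℝ) 0 (M + 1)
          norm_num at this
          exact this
      _ = 1 + 2 * c := by ring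
  -- assemble
  have hcnt0 : 0 ≤ cnt := by positivity
  calc ∑ k ∈ t, ∑ q ∈ A.filter (fun q => f q = k), G q
      ≤ ∑ k ∈ t, cnt * ((L : ℝ) ^ 2 * h k) := sum_le_sum hfib
    _ = cnt * (L : ℝ) ^ 2 * ∑ k ∈ t, h k := by rw [mul_sum]; refine sum_congr rfl fun k _ => ?_; ring
    _ ≤ cnt * (L : ℝ) ^ 2 * (1 + 2 * c) := by gcongr
    _ = 2 * (1 + 2 * c) * ((L : ℝ) ^ 2 + L / δ) := by
        rw [hcnt]
        field_simp
        ring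

/-! #### The Fejér majorant in combinatorial form -/

/-- Each `m ∈ [-T, T]` is `j - k` for at least `T + 1` pairs `(j, k) ∈ [0, 3T]²`, so for
nonnegative `g`: `(T + 1) ∑_{|m| ≤ T} g(m) ≤ ∑_{j, k ≤ 3T} g(j - k)`. [folklore] -/
theorem fejer_majorant (T : ℕ) (g : ℤ → ℝ) (hg : ∀ m, 0 ≤ g m) :
    ((T : ℝ) + 1) * ∑ m ∈ Icc (-(T : ℤ)) T, g m ≤
      ∑ j ∈ range (3 * T + 1), ∑ k ∈ range (3 * T + 1), g ((j : ℤ) - k) := by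
  rw [Finset.sum_comm]
  have hsub : Icc T (2 * T) ⊆ range (3 * T + 1) := by
    intro k hk
    rw [mem_Icc] at hk
    rw [mem_range]
    omega
  have hcard : (Icc T (2 * T)).card = T + 1 := by
    rw [Nat.card_Icc]
    omega
  calc ((T : ℝ) + 1) * ∑ m ∈ Icc (-(T : ℤ)) T, g m
      = ∑ _k ∈ Icc T (2 * T), ∑ m ∈ Icc (-(T : ℤ)) T, g m := by
        rw [sum_const, hcard, nsmul_eq_mul]
        push_cast
        ring
    _ ≤ ∑ k ∈ Icc T (2 * T), ∑ j ∈ range (3 * T + 1), g ((j : ℤ) - k) := by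
        refine sum_le_sum fun k hk => ?_
        rw [mem_Icc] at hk
        have hinj : Set.InjOn (fun j : ℕ => (j : ℤ) - k) (range (3 * T + 1) : Set ℕ) := by
          intro j _ j' _ h
          have : (j : ℤ) = j' := by linarith
          exact_mod_cast this
        rw [← Finset.sum_image (g := fun j : ℕ => (j : ℤ) - k) (f := g) hinj]
        refine sum_le_sum_of_subset_of_nonneg ?_ (fun m _ _ => hg m)
        intro m hm
        rw [mem_Icc] at hm
        rw [mem_image]
        refine ⟨(m + k).toNat, ?_, ?_⟩
        · rw [mem_range]; omega
        · omega
    _ ≤ ∑ k ∈ range (3 * T + 1), ∑ j ∈ range (3 * T + 1), g ((j : ℤ) - k) :=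
        sum_le_sum_of_subset_of_nonneg hsub fun k _ _ => sum_nonneg fun j _ => hg _


/-! #### Elementary bounds used in the row sums -/

/-- Jordan's inequality in absolute values: `(2/π)|x| ≤ |sin x|` for `|x| ≤ π/2`. This is Mathlib's
`Real.mul_abs_le_abs_sin`; the name is kept for the use below. [folklore] -/
theorem two_div_pi_mul_abs_le_abs_sin {x : ℝ} (hx : |x| ≤ π / 2) :
    2 / π * |x| ≤ |Real.sin x| :=
  Real.mul_abs_le_abs_sin hx

/-- `|e^{iα} - 1| ≥ (2/π)|α|` for `|α| ≤ π`. [folklore] -/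
theorem norm_exp_mul_I_sub_one_ge {α : ℝ} (hα : |α| ≤ π) :
    2 / π * |α| ≤ ‖exp (α * I) - 1‖ := by
  rw [mul_comm (α : ℂ) I, Complex.norm_exp_I_mul_ofReal_sub_one, Real.norm_eq_abs, abs_mul,
    abs_two]
  have h : |α / 2| ≤ π / 2 := by rw [abs_div, abs_two]; linarith
  have := two_div_pi_mul_abs_le_abs_sin h
  rw [abs_div, abs_two] at this
  linarith

/-- `|e^{iα} - e^{iβ}| ≤ |α - β|`. [folklore] -/
theorem norm_exp_mul_I_sub_exp_mul_I_le (α β : ℝ) :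
    ‖exp (α * I) - exp (β * I)‖ ≤ |α - β| := by
  have h : exp (α * I) - exp (β * I) = exp (β * I) * (exp (I * (α - β : ℝ)) - 1) := by
    rw [mul_sub, mul_one, ← Complex.exp_add]
    congr 2
    push_cast
    ring
  rw [h, norm_mul, Complex.norm_exp_ofReal_mul_I, one_mul]
  have := Real.norm_exp_I_mul_ofReal_sub_one_le (x := α - β)
  rwa [Real.norm_eq_abs] at this

/-- Geometric sums of a unit `w`: `|∑_{j<L} w^j| ≤ L`, and `≤ 2/|w - 1|` if `w ≠ 1`. [folklore] -/
theorem norm_geom_sum_le {w : ℂ} (hw : ‖w‖ = 1) (L : ℕ) :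
    ‖∑ j ∈ range L, w ^ j‖ ≤ L ∧ (w ≠ 1 → ‖∑ j ∈ range L, w ^ j‖ ≤ 2 / ‖w - 1‖) := by
  constructor
  · calc ‖∑ j ∈ range L, w ^ j‖ ≤ ∑ j ∈ range L, ‖w ^ j‖ := norm_sum_le _ _
      _ = L := by simp [norm_pow, hw]
  · intro h1
    have hw1 : 0 < ‖w - 1‖ := norm_pos_iff.2 (sub_ne_zero.2 h1)
    rw [geom_sum_eq h1, norm_div, div_le_div_iff_of_pos_right hw1]
    calc ‖w ^ L - 1‖ ≤ ‖w ^ L‖ + ‖(1 : ℂ)‖ := norm_sub_le _ _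
      _ = 2 := by rw [norm_pow, hw, one_pow, norm_one]; norm_num

/-- For unit `B`: `|A - B| = |A B̄ - 1|`. [folklore] -/
theorem norm_sub_eq_norm_mul_conj_sub_one (A : ℂ) {B : ℂ} (hB : ‖B‖ = 1) :
    ‖A - B‖ = ‖A * conj B - 1‖ := by
  have hBB : conj B * B = 1 := by
    rw [mul_comm, Complex.mul_conj', hB]; simp
  have : A - B = (A * conj B - 1) * B := by
    calc A - B = A * (conj B * B) - B := by rw [hBB, mul_one]
      _ = (A * conj B - 1) * B := by ring
  rw [this, norm_mul, hB, mul_one]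

/-- Swapping a fourfold sum: `∑_a ∑_b ∑_c ∑_d = ∑_c ∑_d ∑_a ∑_b`. [folklore] -/
theorem sum_comm_four {α β γ κ M : Type*} [AddCommMonoid M] (s : Finset α) (t : Finset β)
    (s' : Finset γ) (t' : Finset κ) (f : α → β → γ → κ → M) :
    ∑ a ∈ s, ∑ b ∈ t, ∑ c ∈ s', ∑ d ∈ t', f a b c d =
      ∑ c ∈ s', ∑ d ∈ t', ∑ a ∈ s, ∑ b ∈ t, f a b c d := by
  calc ∑ a ∈ s, ∑ b ∈ t, ∑ c ∈ s', ∑ d ∈ t', f a b c d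
      = ∑ a ∈ s, ∑ c ∈ s', ∑ b ∈ t, ∑ d ∈ t', f a b c d :=
        sum_congr rfl fun _ _ => Finset.sum_comm
    _ = ∑ c ∈ s', ∑ a ∈ s, ∑ b ∈ t, ∑ d ∈ t', f a b c d := Finset.sum_comm
    _ = ∑ c ∈ s', ∑ a ∈ s, ∑ d ∈ t', ∑ b ∈ t, f a b c d :=
        sum_congr rfl fun _ _ => sum_congr rfl fun _ _ => Finset.sum_comm
    _ = ∑ c ∈ s', ∑ d ∈ t', ∑ a ∈ s, ∑ b ∈ t, f a b c d :=
        sum_congr rfl fun _ _ => Finset.sum_comm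

/-! #### The dual large sieve on the unit circle (Harman §A.3, proof of Lemma 11.1) -/

/-- **Dual large sieve for well-spaced points of the unit circle.** If `u_p` (`p ∈ P`) are
points of the unit circle with pairwise chordal distance `≥ δ`, then for all coefficients `b_p`
and `T ≥ 1`,
`∑_{|m| ≤ T} |∑_p b_p u_p^m|² ≤ 24 (1 + 2π²) (T + 1/δ) ∑_p |b_p|²`.
This is Harman's argument in §A.3 (Fejér weights in `m`, multiply out,
`|b_p b_q| ≤ (|b_p|² + |b_q|²)/2`, kernel `≪ min (T², ‖x‖⁻²)/T`, sum over `δ`-spaced points),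
with the Fejér weights realised combinatorially as `#{(j, k) ∈ [0, 3T]² : j - k = m} ≥ T + 1`
and the kernel as `|∑_{j ≤ 3T} w^j|²`. [cite: Harman2007, §A.3 (PDF pp. 291–292), proof of Lemma 11.1] -/
theorem dual_large_sieve_circle {ι : Type*} [DecidableEq ι] (P : Finset ι) (u : ι → ℂ)
    (hu : ∀ p ∈ P, ‖u p‖ = 1) {δ : ℝ} (hδ : 0 < δ)
    (hsep : ∀ p ∈ P, ∀ q ∈ P, p ≠ q → δ ≤ ‖u p - u q‖) (b : ι → ℂ) {T : ℕ} (hT : 1 ≤ T) :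
    ∑ m ∈ Icc (-(T : ℤ)) T, ‖∑ p ∈ P, b p * u p ^ m‖ ^ 2 ≤
      24 * (1 + 2 * π ^ 2) * (T + 1 / δ) * ∑ p ∈ P, ‖b p‖ ^ 2 := by
  set L : ℕ := 3 * T + 1 with hL
  have hL1 : 1 ≤ L := by omega
  set F : ℤ → ℂ := fun m => ∑ p ∈ P, b p * u p ^ m with hF
  set H : ℕ → ℕ → ℂ := fun j k => ∑ p ∈ P, b p * (u p ^ j * conj (u p) ^ k) with hH
  have hu0 : ∀ p ∈ P, u p ≠ 0 := fun p hp h => by simpa [h] using hu p hp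
  -- `F(j - k) = H(j, k)`
  have hFH : ∀ j k : ℕ, F ((j : ℤ) - k) = H j k := by
    intro j k
    simp only [hF, hH]
    refine sum_congr rfl fun p hp => ?_
    rw [zpow_sub₀ (hu0 p hp), zpow_natCast, zpow_natCast, div_eq_mul_inv, ← inv_pow,
      Complex.inv_eq_conj (hu p hp)]
  -- Step 3: the Fejér majorant
  have h3 := fejer_majorant T (fun m => ‖F m‖ ^ 2) (fun m => by positivity)
  simp only [hFH] at h3
  -- Step 4: multiply out
  set D : ι → ι → ℂ := fun p q => ∑ j ∈ range L, (u p * conj (u q)) ^ j with hD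
  have hx : ∀ j k : ℕ, ((‖H j k‖ : ℂ)) ^ 2 =
      ∑ p ∈ P, ∑ q ∈ P, b p * conj (b q) * ((u p * conj (u q)) ^ j * (conj (u p) * u q) ^ k) := by
    intro j k
    rw [← Complex.mul_conj', hH, map_sum, sum_mul_sum]
    refine sum_congr rfl fun p _ => sum_congr rfl fun q _ => ?_
    simp only [map_mul, map_pow, Complex.conj_conj]
    ring
  have hDD : ∀ p q, ((‖D p q‖ : ℂ)) ^ 2 =
      ∑ j ∈ range L, ∑ k ∈ range L, (u p * conj (u q)) ^ j * (conj (u p) * u q) ^ k := by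
    intro p q
    rw [← Complex.mul_conj', hD, map_sum, sum_mul_sum]
    refine sum_congr rfl fun j _ => sum_congr rfl fun k _ => ?_
    rw [map_pow, map_mul, Complex.conj_conj]
  have hident : ((∑ j ∈ range L, ∑ k ∈ range L, ‖H j k‖ ^ 2 : ℝ) : ℂ) =
      ∑ p ∈ P, ∑ q ∈ P, b p * conj (b q) * ((‖D p q‖ : ℂ)) ^ 2 := by
    push_cast
    simp_rw [hx]
    rw [sum_comm_four]
    refine sum_congr rfl fun p _ => sum_congr rfl fun q _ => ?_
    rw [hDD, mul_sum]
    refine sum_congr rfl fun j _ => ?_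
    rw [mul_sum]
  have h4 : ∑ j ∈ range L, ∑ k ∈ range L, ‖H j k‖ ^ 2 ≤
      ∑ p ∈ P, ∑ q ∈ P, ‖b p‖ * ‖b q‖ * ‖D p q‖ ^ 2 := by
    have h0 : 0 ≤ ∑ j ∈ range L, ∑ k ∈ range L, ‖H j k‖ ^ 2 :=
      sum_nonneg fun _ _ => sum_nonneg fun _ _ => by positivity
    calc ∑ j ∈ range L, ∑ k ∈ range L, ‖H j k‖ ^ 2
        = ‖((∑ j ∈ range L, ∑ k ∈ range L, ‖H j k‖ ^ 2 : ℝ) : ℂ)‖ :=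
          (Complex.norm_of_nonneg h0).symm
      _ = ‖∑ p ∈ P, ∑ q ∈ P, b p * conj (b q) * ((‖D p q‖ : ℂ)) ^ 2‖ := by rw [hident]
      _ ≤ ∑ p ∈ P, ‖∑ q ∈ P, b p * conj (b q) * ((‖D p q‖ : ℂ)) ^ 2‖ := norm_sum_le _ _
      _ ≤ ∑ p ∈ P, ∑ q ∈ P, ‖b p * conj (b q) * ((‖D p q‖ : ℂ)) ^ 2‖ :=
          sum_le_sum fun _ _ => norm_sum_le _ _
      _ = ∑ p ∈ P, ∑ q ∈ P, ‖b p‖ * ‖b q‖ * ‖D p q‖ ^ 2 := by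
          refine sum_congr rfl fun p _ => sum_congr rfl fun q _ => ?_
          rw [norm_mul, norm_mul, Complex.norm_conj, norm_pow, Complex.norm_real, norm_norm]
  -- Step 5: the kernel bounds
  have hK1 : ∀ p ∈ P, ∀ q ∈ P, ‖D p q‖ ^ 2 ≤ (L : ℝ) ^ 2 := by
    intro p hp q hq
    have hw : ‖u p * conj (u q)‖ = 1 := by rw [norm_mul, Complex.norm_conj, hu p hp, hu q hq, mul_one]
    have := (norm_geom_sum_le hw L).1
    exact pow_le_pow_left₀ (norm_nonneg _) this 2
  have hK2 : ∀ p ∈ P, ∀ q ∈ P, u p ≠ u q → ‖D p q‖ ^ 2 ≤ 4 / ‖u p - u q‖ ^ 2 := by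
    intro p hp q hq hne
    have hw : ‖u p * conj (u q)‖ = 1 := by rw [norm_mul, Complex.norm_conj, hu p hp, hu q hq, mul_one]
    have hch : ‖u p * conj (u q) - 1‖ = ‖u p - u q‖ :=
      (norm_sub_eq_norm_mul_conj_sub_one (u p) (hu q hq)).symm
    have hw1 : u p * conj (u q) ≠ 1 := by
      intro h1
      have : ‖u p - u q‖ = 0 := by rw [← hch, h1, sub_self, norm_zero]
      exact hne (sub_eq_zero.1 (norm_eq_zero.1 this))
    have := (norm_geom_sum_le hw L).2 hw1
    rw [hch] at this
    calc ‖D p q‖ ^ 2 ≤ (2 / ‖u p - u q‖) ^ 2 := pow_le_pow_left₀ (norm_nonneg _) this 2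
      _ = 4 / ‖u p - u q‖ ^ 2 := by rw [div_pow]; norm_num
  -- Step 6: the row (and column) sums
  set R : ℝ := 2 * (1 + 2 * π ^ 2) * ((L : ℝ) ^ 2 + L / δ) with hR
  have hrow : ∀ p ∈ P, ∀ G : ι → ℝ, (∀ q ∈ P, G q ≤ (L : ℝ) ^ 2) →
      (∀ q ∈ P, u p ≠ u q → G q ≤ 4 / ‖u p - u q‖ ^ 2) → ∑ q ∈ P, G q ≤ R := by
    intro p hp G hG1 hG2
    -- angles relative to `u p`
    set α : ι → ℝ := fun q => arg (u q * conj (u p)) with hα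
    have hexp : ∀ q ∈ P, exp (α q * I) = u q * conj (u p) := by
      intro q hq
      have h1 : ‖u q * conj (u p)‖ = 1 := by
        rw [norm_mul, Complex.norm_conj, hu p hp, hu q hq, mul_one]
      have := norm_mul_exp_arg_mul_I (u q * conj (u p))
      rwa [h1, Complex.ofReal_one, one_mul] at this
    have hchord : ∀ q ∈ P, ‖u p - u q‖ = ‖exp (α q * I) - 1‖ := by
      intro q hq
      rw [hexp q hq, norm_sub_rev, norm_sub_eq_norm_mul_conj_sub_one (u q) (hu p hp)]
    refine sum_le_of_separated P α hδ ?_ hL1 (c := π ^ 2) (by positivity) G hG1 ?_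
    · -- separation of the angles
      intro q hq q' hq' hne
      calc δ ≤ ‖u q - u q'‖ := hsep q hq q' hq' hne
        _ = ‖(u q - u q') * conj (u p)‖ := by rw [norm_mul, Complex.norm_conj, hu p hp, mul_one]
        _ = ‖exp (α q * I) - exp (α q' * I)‖ := by rw [sub_mul, hexp q hq, hexp q' hq']
        _ ≤ |α q - α q'| := norm_exp_mul_I_sub_exp_mul_I_le _ _
    · -- the kernel bound in terms of the angle
      intro q hq hα0
      have hne : u p ≠ u q := by
        intro h
        apply hα0
        simp only [hα]
        rw [← h, Complex.mul_conj', hu p hp]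
        simp
      have hpos : 0 < 2 / π * |α q| := by positivity
      have hge : 2 / π * |α q| ≤ ‖u p - u q‖ := by
        rw [hchord q hq]
        exact norm_exp_mul_I_sub_one_ge (abs_arg_le_pi _)
      calc G q ≤ 4 / ‖u p - u q‖ ^ 2 := hG2 q hq hne
        _ ≤ 4 / (2 / π * |α q|) ^ 2 := by
            gcongr
        _ = π ^ 2 / (α q) ^ 2 := by
            field_simp
            rw [sq_abs]
            ring
  -- the "familiar technique": `|b_p b_q| ≤ (|b_p|² + |b_q|²)/2`
  have h5 : ∑ p ∈ P, ∑ q ∈ P, ‖b p‖ * ‖b q‖ * ‖D p q‖ ^ 2 ≤ R * ∑ p ∈ P, ‖b p‖ ^ 2 := by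
    have hrow' : ∀ p ∈ P, ∑ q ∈ P, ‖D p q‖ ^ 2 ≤ R := fun p hp =>
      hrow p hp (fun q => ‖D p q‖ ^ 2) (fun q hq => hK1 p hp q hq) (fun q hq hne => hK2 p hp q hq hne)
    have hcol' : ∀ q ∈ P, ∑ p ∈ P, ‖D p q‖ ^ 2 ≤ R := fun q hq =>
      hrow q hq (fun p => ‖D p q‖ ^ 2) (fun p hp => hK1 p hp q hq)
        (fun p hp hne => by rw [norm_sub_rev]; exact hK2 p hp q hq (Ne.symm hne))
    calc ∑ p ∈ P, ∑ q ∈ P, ‖b p‖ * ‖b q‖ * ‖D p q‖ ^ 2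
        ≤ ∑ p ∈ P, ∑ q ∈ P, (‖b p‖ ^ 2 / 2 * ‖D p q‖ ^ 2 + ‖b q‖ ^ 2 / 2 * ‖D p q‖ ^ 2) := by
          refine sum_le_sum fun p _ => sum_le_sum fun q _ => ?_
          rw [← add_mul]
          refine mul_le_mul_of_nonneg_right ?_ (by positivity)
          nlinarith [two_mul_le_add_sq ‖b p‖ ‖b q‖]
      _ = ∑ p ∈ P, (‖b p‖ ^ 2 / 2 * ∑ q ∈ P, ‖D p q‖ ^ 2) +
            ∑ q ∈ P, (‖b q‖ ^ 2 / 2 * ∑ p ∈ P, ‖D p q‖ ^ 2) := by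
          have hsplit : ∑ p ∈ P, ∑ q ∈ P, (‖b p‖ ^ 2 / 2 * ‖D p q‖ ^ 2 + ‖b q‖ ^ 2 / 2 * ‖D p q‖ ^ 2)
              = ∑ p ∈ P, ∑ q ∈ P, ‖b p‖ ^ 2 / 2 * ‖D p q‖ ^ 2 +
                ∑ p ∈ P, ∑ q ∈ P, ‖b q‖ ^ 2 / 2 * ‖D p q‖ ^ 2 := by
            rw [← sum_add_distrib]
            exact sum_congr rfl fun p _ => sum_add_distrib
          rw [hsplit]
          congr 1
          · simp_rw [mul_sum]
          · rw [Finset.sum_comm]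
            simp_rw [mul_sum]
      _ ≤ ∑ p ∈ P, (‖b p‖ ^ 2 / 2 * R) + ∑ q ∈ P, (‖b q‖ ^ 2 / 2 * R) := by
          gcongr with p hp q hq
          · exact hrow' p hp
          · exact hcol' q hq
      _ = R * ∑ p ∈ P, ‖b p‖ ^ 2 := by
          rw [← sum_mul]
          simp_rw [div_eq_mul_inv]
          rw [← sum_mul]
          ring
  -- assemble: `(T + 1) S ≤ R ∑ |b|²` and `R ≤ 12 (T + 1) · 2 (1 + 2π²) (T + 1/δ)`
  have hmain : ((T : ℝ) + 1) * ∑ m ∈ Icc (-(T : ℤ)) T, ‖F m‖ ^ 2 ≤ R * ∑ p ∈ P, ‖b p‖ ^ 2 :=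
    h3.trans (h4.trans h5)
  have hT1 : (0 : ℝ) < (T : ℝ) + 1 := by positivity
  have hB : 0 ≤ ∑ p ∈ P, ‖b p‖ ^ 2 := sum_nonneg fun _ _ => by positivity
  have hRle : R ≤ ((T : ℝ) + 1) * (24 * (1 + 2 * π ^ 2) * (T + 1 / δ)) := by
    have hT' : (1 : ℝ) ≤ T := by exact_mod_cast hT
    have hLr : (L : ℝ) = 3 * T + 1 := by rw [hL]; push_cast; ring
    rw [hR, hLr]
    have h1 : (3 * (T : ℝ) + 1) ^ 2 ≤ 12 * T * (T + 1) := by nlinarith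
    have h2 : (3 * (T : ℝ) + 1) / δ ≤ 12 * (T + 1) / δ := by
      rw [div_le_div_iff_of_pos_right hδ]; linarith
    have hπ : (0 : ℝ) ≤ 1 + 2 * π ^ 2 := by positivity
    calc 2 * (1 + 2 * π ^ 2) * ((3 * (T : ℝ) + 1) ^ 2 + (3 * (T : ℝ) + 1) / δ)
        ≤ 2 * (1 + 2 * π ^ 2) * (12 * T * (T + 1) + 12 * (T + 1) / δ) := by gcongr
      _ = ((T : ℝ) + 1) * (24 * (1 + 2 * π ^ 2) * (T + 1 / δ)) := by
          field_simp
          ring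
  have := hmain.trans (mul_le_mul_of_nonneg_right hRle hB)
  rw [mul_assoc] at this
  exact le_of_mul_le_mul_left this hT1


/-! #### Regrouping the Hecke polynomial along rays (Harman §A.3, first display) -/

/-- `z/|z| = e^{i arg z}` for `z ≠ 0`. [folklore] -/
theorem div_norm_eq_exp {z : ℂ} (hz : z ≠ 0) : z / (‖z‖ : ℂ) = exp (arg z * I) := by
  rw [div_eq_iff (by exact_mod_cast (norm_ne_zero_iff.mpr hz)), mul_comm]
  exact (norm_mul_exp_arg_mul_I z).symm

/-- Elements of `ℤ[i]*` are nonzero complex numbers. [folklore] -/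
theorem toComplex_ne_zero_of_mem {n : GaussianInt} (hn : n ∈ firstQuadrant) : (n : ℂ) ≠ 0 := by
  rw [Ne, GaussianInt.toComplex_eq_zero]; exact ne_zero_of_mem_firstQuadrant hn

/-- `λ^m` is constant on rays: it only depends on `arg`. [folklore] -/
theorem angularCharZ_eq_of_arg_eq (m : ℤ) {v p : GaussianInt} (hv : v ∈ firstQuadrant)
    (hp : p ∈ firstQuadrant) (h : arg (v : ℂ) = arg (p : ℂ)) :
    angularCharZ m v = angularCharZ m p := by
  rw [angularCharZ, angularCharZ, div_norm_eq_exp (toComplex_ne_zero_of_mem hv),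
    div_norm_eq_exp (toComplex_ne_zero_of_mem hp), h]

/-- Every `v ∈ ℤ[i]*` has a primitive `p ∈ ℤ[i]*` on its ray with `N(p) ≤ N(v)` (divide by
the content). [folklore] -/
theorem exists_primitive_of_mem_firstQuadrant {v : GaussianInt} (hv : v ∈ firstQuadrant) :
    ∃ p : GaussianInt, p ∈ firstQuadrant ∧ IsPrimitive p ∧ p.norm ≤ v.norm ∧
      arg (p : ℂ) = arg (v : ℂ) := by
  obtain ⟨hre, him⟩ := mem_firstQuadrant.1 hv
  have hg : 0 < Int.gcd v.re v.im := Int.gcd_pos_of_ne_zero_left _ hre.ne'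
  obtain ⟨g, a, b, hg0, hab, ha, hb⟩ := Int.exists_gcd_one' hg
  have hvp : v = (g : GaussianInt) * ⟨a, b⟩ := by
    obtain ⟨h1, h2⟩ := natCast_mul_re_im g ⟨a, b⟩
    ext
    · rw [h1, ha, mul_comm]
    · rw [h2, hb, mul_comm]
  have hg0' : (0 : ℤ) < g := by exact_mod_cast hg0
  have hpq : (⟨a, b⟩ : GaussianInt) ∈ firstQuadrant := by
    rw [mem_firstQuadrant]
    constructor
    · by_contra h
      push Not at h
      have : v.re ≤ 0 := by rw [ha]; exact mul_nonpos_of_nonpos_of_nonneg h hg0'.le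
      linarith
    · by_contra h
      push Not at h
      have : v.im < 0 := by rw [hb]; exact mul_neg_of_neg_of_pos h hg0'
      linarith
  refine ⟨⟨a, b⟩, hpq, hab, ?_, ?_⟩
  · rw [hvp, norm_natCast_mul]
    have hn : 0 ≤ (⟨a, b⟩ : GaussianInt).norm := GaussianInt.norm_nonneg _
    have hg1 : (1 : ℤ) ≤ (g : ℤ) ^ 2 := by nlinarith
    nlinarith
  · rw [hvp, arg_natCast_mul hg0]

/-- **Regrouping along rays**: `∑_{N(n) ≤ N} a_n λ^m(n) = ∑'_{p primitive} a_p' λ^m(p)`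
(Harman §A.3, first display of the proof of Lemma 11.1). [cite: Harman2007, §A.3 (PDF pp. 291–292)] -/
theorem heckeSum_eq_sum_primitive (N : ℝ) (a : GaussianInt → ℂ) (m : ℤ) :
    heckeSum N a m =
      ∑ p ∈ (normLEStar N).filter IsPrimitive, rayCoeff N a p * angularCharZ m p := by
  have h1 : ∀ p ∈ (normLEStar N).filter IsPrimitive, rayCoeff N a p * angularCharZ m p =
      ∑ v ∈ normLEStar N,
        if arg (v : ℂ) = arg (p : ℂ) then a v * angularCharZ m v else 0 := by
    intro p hp
    rw [mem_filter, mem_normLEStar] at hp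
    rw [rayCoeff, sum_filter, sum_mul]
    refine sum_congr rfl fun v hv => ?_
    rw [mem_normLEStar] at hv
    split_ifs with h
    · rw [angularCharZ_eq_of_arg_eq m hv.2 hp.1.2 h]
    · rw [zero_mul]
  rw [sum_congr rfl h1, sum_comm, heckeSum]
  refine sum_congr rfl fun v hv => ?_
  rw [mem_normLEStar] at hv
  rw [← sum_filter]
  obtain ⟨p₀, hp₀q, hp₀prim, hp₀norm, hp₀arg⟩ := exists_primitive_of_mem_firstQuadrant hv.2
  have hp₀S : p₀ ∈ (normLEStar N).filter IsPrimitive := by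
    rw [mem_filter, mem_normLEStar]
    exact ⟨⟨le_trans (by exact_mod_cast hp₀norm) hv.1, hp₀q⟩, hp₀prim⟩
  have hsingle : ((normLEStar N).filter IsPrimitive).filter
      (fun p : GaussianInt => arg (v : ℂ) = arg (p : ℂ)) = {p₀} := by
    refine eq_singleton_iff_unique_mem.2 ⟨?_, ?_⟩
    · rw [mem_filter]; exact ⟨hp₀S, hp₀arg.symm⟩
    · intro p hp
      rw [mem_filter, mem_filter, mem_normLEStar] at hp
      exact eq_of_isPrimitive_of_arg_eq hp.1.1.2 hp.1.2 hp₀q hp₀prim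
        (hp.2.symm.trans hp₀arg.symm)
  rw [hsingle, sum_singleton]

/-- `λ^m(z) = u(z)^m` with `u(z) = (z/|z|)^4`. [folklore] -/
theorem angularCharZ_eq_zpow (m : ℤ) (z : GaussianInt) :
    angularCharZ m z = (((z : ℂ) / (‖(z : ℂ)‖ : ℂ)) ^ 4) ^ m := by
  rw [angularCharZ, zpow_mul]
  norm_cast

/-- `|u(z)| = 1` for `z ∈ ℤ[i]*`. [folklore] -/
theorem norm_unit4_eq_one {z : GaussianInt} (hz : z ∈ firstQuadrant) :
    ‖((z : ℂ) / (‖(z : ℂ)‖ : ℂ)) ^ 4‖ = 1 := by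
  have hz' := toComplex_ne_zero_of_mem hz
  have h1 : ‖(z : ℂ) / (‖(z : ℂ)‖ : ℂ)‖ = 1 := by
    rw [norm_div, Complex.norm_real, Real.norm_eq_abs, abs_norm,
      div_self (norm_ne_zero_iff.mpr hz')]
  rw [norm_pow, h1, one_pow]

/-! #### Angular separation of primitive points (Harman: `N⁻¹ ≫ δ ≫ N⁻¹`) -/

/-- `|(Z/|Z|)^4 - 1| = 4 |re Z| |im Z| / |Z|²` for `Z ≠ 0` (`e² ∓ 1 = Z (Z ∓ Z̄)/|Z|²`).
[folklore] -/
theorem norm_div_norm_pow_four_sub_one {Z : ℂ} (hZ : Z ≠ 0) :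
    ‖(Z / (‖Z‖ : ℂ)) ^ 4 - 1‖ = 4 * |Z.re| * |Z.im| / ‖Z‖ ^ 2 := by
  have hn : (‖Z‖ : ℝ) ≠ 0 := norm_ne_zero_iff.mpr hZ
  have hn' : ((‖Z‖ : ℝ) : ℂ) ≠ 0 := by exact_mod_cast hn
  have hn2 : ((‖Z‖ : ℝ) : ℂ) ^ 2 ≠ 0 := pow_ne_zero _ hn'
  have hZZ : ((‖Z‖ : ℝ) : ℂ) ^ 2 = Z * conj Z := (Complex.mul_conj' Z).symm
  set e : ℂ := Z / (‖Z‖ : ℂ) with he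
  have he2 : e ^ 2 = Z ^ 2 / ((‖Z‖ : ℝ) : ℂ) ^ 2 := by rw [he, div_pow]
  have hsub : e ^ 2 - 1 = Z * ((2 * Z.im : ℝ) * I) / ((‖Z‖ : ℝ) : ℂ) ^ 2 := by
    rw [← Complex.sub_conj, he2, div_sub_one hn2, hZZ]
    ring
  have hadd : e ^ 2 + 1 = Z * ((2 * Z.re : ℝ) : ℂ) / ((‖Z‖ : ℝ) : ℂ) ^ 2 := by
    rw [← Complex.add_conj, he2, div_add_one hn2, hZZ]
    ring
  have hfac : e ^ 4 - 1 = (e ^ 2 - 1) * (e ^ 2 + 1) := by ring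
  rw [hfac, norm_mul, hsub, hadd]
  simp only [norm_div, norm_mul, norm_pow, Complex.norm_real, Real.norm_eq_abs, Complex.norm_I,
    mul_one, abs_norm]
  rw [abs_two]
  field_simp
  ring

/-- `‖(p : ℂ)‖² = N(p)`. [folklore] -/
theorem norm_toComplex_sq (p : GaussianInt) : ‖(p : ℂ)‖ ^ 2 = (p.norm : ℝ) := by
  rw [GaussianInt.intCast_real_norm, Complex.normSq_eq_norm_sq]

/-- `‖(p : ℂ)‖ ≤ √N` when `N(p) ≤ N`. [folklore] -/
theorem norm_toComplex_le_sqrt {p : GaussianInt} {N : ℝ} (hpN : (p.norm : ℝ) ≤ N) :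
    ‖(p : ℂ)‖ ≤ Real.sqrt N := by
  rw [← Real.sqrt_sq (norm_nonneg (p : ℂ))]
  exact Real.sqrt_le_sqrt (by rw [norm_toComplex_sq]; exact hpN)

/-- Two points of `ℤ[i]*` with `im (p q̄) = 0` have the same argument. [folklore] -/
theorem arg_eq_of_im_mul_conj_eq_zero {p q : GaussianInt} (hp : p ∈ firstQuadrant)
    (hq : q ∈ firstQuadrant) (h : ((p : ℂ) * conj (q : ℂ)).im = 0) :
    arg (p : ℂ) = arg (q : ℂ) := by
  have hq0 := toComplex_ne_zero_of_mem hq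
  set Z : ℂ := (p : ℂ) * conj (q : ℂ) with hZ
  -- `re Z ≥ 1`
  have hre : Z.re = (p.re : ℝ) * q.re + (p.im : ℝ) * q.im := by
    simp only [hZ, mul_re, conj_re, conj_im, GaussianInt.intCast_re, GaussianInt.intCast_im]
    ring
  have hre_pos : 0 < Z.re := by
    rw [hre]
    obtain ⟨hp1, hp2⟩ := mem_firstQuadrant.1 hp
    obtain ⟨hq1, hq2⟩ := mem_firstQuadrant.1 hq
    have h1 : (1 : ℝ) ≤ p.re := by exact_mod_cast hp1
    have h2 : (1 : ℝ) ≤ q.re := by exact_mod_cast hq1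
    have h3 : (0 : ℝ) ≤ p.im := by exact_mod_cast hp2
    have h4 : (0 : ℝ) ≤ q.im := by exact_mod_cast hq2
    nlinarith
  have hZre : Z = (Z.re : ℂ) := by
    apply Complex.ext <;> simp [h]
  -- `p · |q|² = re Z · q`
  have hnq : (Complex.normSq (q : ℂ) : ℂ) ≠ 0 := by
    exact_mod_cast (Complex.normSq_pos.2 hq0).ne'
  have hpq : (p : ℂ) = ((Z.re / Complex.normSq (q : ℂ) : ℝ) : ℂ) * (q : ℂ) := by
    have h1 : (p : ℂ) * (Complex.normSq (q : ℂ) : ℂ) = (Z.re : ℂ) * (q : ℂ) := by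
      rw [← Complex.mul_conj]
      calc (p : ℂ) * ((q : ℂ) * conj (q : ℂ)) = Z * (q : ℂ) := by rw [hZ]; ring
        _ = (Z.re : ℂ) * (q : ℂ) := by rw [← hZre]
    push_cast
    rw [div_mul_eq_mul_div, eq_div_iff hnq, h1]
  have hr : 0 < Z.re / Complex.normSq (q : ℂ) := div_pos hre_pos (Complex.normSq_pos.2 hq0)
  rw [hpq, Complex.arg_real_mul _ hr]

/-- **Angular separation** (Harman §A.3: "`N⁻¹ ≫ δ ≫ N⁻¹`", made explicit): for `p ≠ q`
primitive in `ℤ[i]*` with `N(p), N(q) ≤ N`, the points `u(p) = (p/|p|)^4`, `u(q)` of the unit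
circle satisfy `|u(p) - u(q)| ≥ 2/N`. [cite: Harman2007, §A.3 (PDF pp. 291–292)] -/
theorem norm_unit4_sub_unit4_ge {p q : GaussianInt} {N : ℝ} (hp : p ∈ firstQuadrant)
    (hpp : IsPrimitive p) (hq : q ∈ firstQuadrant) (hqp : IsPrimitive q) (hne : p ≠ q)
    (hpN : (p.norm : ℝ) ≤ N) (hqN : (q.norm : ℝ) ≤ N) :
    2 / N ≤ ‖((p : ℂ) / (‖(p : ℂ)‖ : ℂ)) ^ 4 - ((q : ℂ) / (‖(q : ℂ)‖ : ℂ)) ^ 4‖ := by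
  have hp0 := toComplex_ne_zero_of_mem hp
  have hq0 := toComplex_ne_zero_of_mem hq
  set Z : ℂ := (p : ℂ) * conj (q : ℂ) with hZ
  have hZ0 : Z ≠ 0 := mul_ne_zero hp0 ((map_ne_zero _).2 hq0)
  have hnZ : ‖Z‖ = ‖(p : ℂ)‖ * ‖(q : ℂ)‖ := by rw [hZ, norm_mul, Complex.norm_conj]
  -- rewrite the chord through `Z`
  have hchord : ‖((p : ℂ) / (‖(p : ℂ)‖ : ℂ)) ^ 4 - ((q : ℂ) / (‖(q : ℂ)‖ : ℂ)) ^ 4‖ =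
      ‖(Z / (‖Z‖ : ℂ)) ^ 4 - 1‖ := by
    rw [norm_sub_eq_norm_mul_conj_sub_one _ (norm_unit4_eq_one hq), map_pow, ← mul_pow]
    congr 3
    rw [map_div₀, Complex.conj_ofReal, hnZ, hZ]
    push_cast
    rw [div_mul_div_comm]
  rw [hchord, norm_div_norm_pow_four_sub_one hZ0]
  -- `re Z ≥ 1`, `|im Z| ≥ 1`
  have hre : Z.re = (p.re : ℝ) * q.re + (p.im : ℝ) * q.im := by
    simp only [hZ, mul_re, conj_re, conj_im, GaussianInt.intCast_re, GaussianInt.intCast_im]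
    ring
  have him : Z.im = ((p.im * q.re - p.re * q.im : ℤ) : ℝ) := by
    push_cast
    simp only [hZ, mul_im, conj_re, conj_im, GaussianInt.intCast_re, GaussianInt.intCast_im]
    ring
  have hre1 : 1 ≤ |Z.re| := by
    rw [hre]
    obtain ⟨hp1, hp2⟩ := mem_firstQuadrant.1 hp
    obtain ⟨hq1, hq2⟩ := mem_firstQuadrant.1 hq
    have h1 : (1 : ℝ) ≤ p.re := by exact_mod_cast hp1
    have h2 : (1 : ℝ) ≤ q.re := by exact_mod_cast hq1
    have h3 : (0 : ℝ) ≤ p.im := by exact_mod_cast hp2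
    have h4 : (0 : ℝ) ≤ q.im := by exact_mod_cast hq2
    rw [abs_of_nonneg (by nlinarith)]
    nlinarith
  have him1 : 1 ≤ |Z.im| := by
    have hne0 : Z.im ≠ 0 := by
      intro h0
      exact hne (eq_of_isPrimitive_of_arg_eq hp hpp hq hqp
        (arg_eq_of_im_mul_conj_eq_zero hp hq h0))
    have hk : (p.im * q.re - p.re * q.im : ℤ) ≠ 0 := by
      intro hk; apply hne0; rw [him, hk]; simp
    rw [him, ← Int.cast_abs]
    exact_mod_cast Int.one_le_abs hk
  -- `4 |re Z| |im Z| ≥ 2 (|re Z| + |im Z|) ≥ 2 |Z|`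
  have hnormZ : 0 < ‖Z‖ := norm_pos_iff.2 hZ0
  have h4 : 2 * ‖Z‖ ≤ 4 * |Z.re| * |Z.im| := by
    have := Complex.norm_le_abs_re_add_abs_im Z
    nlinarith
  have hZN : ‖Z‖ ≤ N := by
    rw [hnZ]
    have hN : 0 ≤ N := le_trans (by exact_mod_cast GaussianInt.norm_nonneg p) hpN
    calc ‖(p : ℂ)‖ * ‖(q : ℂ)‖ ≤ Real.sqrt N * Real.sqrt N :=
          mul_le_mul (norm_toComplex_le_sqrt hpN) (norm_toComplex_le_sqrt hqN)
            (norm_nonneg _) (Real.sqrt_nonneg _)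
      _ = N := Real.mul_self_sqrt hN
  calc 2 / N ≤ 2 / ‖Z‖ := div_le_div_of_nonneg_left (by norm_num) hnormZ hZN
    _ = 2 * ‖Z‖ / ‖Z‖ ^ 2 := by field_simp
    _ ≤ 4 * |Z.re| * |Z.im| / ‖Z‖ ^ 2 := by gcongr

end HeckeMVT

open HeckeMVT in
/-- **The mean value theorem for Hecke polynomials holds** (Järviniemi–Teräväinen 2024,
Lemma 3.2, first display; Harman 2007, Lemma 11.1, proof of §A.3): with `C = 24 (1 + 2π²)`,
for `N ≥ 1`, `T ≥ 1` and all coefficients,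
`∑_{|m| ≤ T} |∑_{N(n) ≤ N} a_n λ^m(n)|² ≤ C (N + T) ∑'_{N(n) ≤ N, n primitive} |a_n'|²`.
Discharges the named fact `JarviniemiTeravainen2024_heckeMVT`.
[cite: Harman2007, Lemma 11.1 (PDF p. 205) and §A.3 (PDF pp. 291–292)]
[cite: JarviniemiTeravainen2024, Lemma 3.2] -/
theorem JarviniemiTeravainen2024_heckeMVT_holds : JarviniemiTeravainen2024_heckeMVT := by
  refine ⟨24 * (1 + 2 * π ^ 2), fun N T a hN hT => ?_⟩
  set P := (normLEStar N).filter IsPrimitive with hP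
  set u : GaussianInt → ℂ := fun p => ((p : ℂ) / (‖(p : ℂ)‖ : ℂ)) ^ 4 with hu_def
  have hF : ∀ m : ℤ, heckeSum N a m = ∑ p ∈ P, rayCoeff N a p * u p ^ m := by
    intro m
    rw [heckeSum_eq_sum_primitive]
    refine sum_congr rfl fun p _ => ?_
    rw [angularCharZ_eq_zpow]
  have hmemP : ∀ p ∈ P, p ∈ firstQuadrant ∧ IsPrimitive p ∧ (p.norm : ℝ) ≤ N := by
    intro p hp
    rw [hP, mem_filter, mem_normLEStar] at hp
    exact ⟨hp.1.2, hp.2, hp.1.1⟩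
  have hu : ∀ p ∈ P, ‖u p‖ = 1 := fun p hp => norm_unit4_eq_one (hmemP p hp).1
  have hN0 : 0 < N := by linarith
  have hδ : (0 : ℝ) < 2 / N := by positivity
  have hsep : ∀ p ∈ P, ∀ q ∈ P, p ≠ q → 2 / N ≤ ‖u p - u q‖ := by
    intro p hp q hq hne
    obtain ⟨hp1, hp2, hp3⟩ := hmemP p hp
    obtain ⟨hq1, hq2, hq3⟩ := hmemP q hq
    exact norm_unit4_sub_unit4_ge hp1 hp2 hq1 hq2 hne hp3 hq3
  have hls := dual_large_sieve_circle P u hu hδ hsep (fun p => rayCoeff N a p) hT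
  simp only [hF]
  refine hls.trans ?_
  have hS : 0 ≤ ∑ p ∈ P, ‖rayCoeff N a p‖ ^ 2 := sum_nonneg fun _ _ => by positivity
  refine mul_le_mul_of_nonneg_right ?_ hS
  have hπ : (0 : ℝ) ≤ 24 * (1 + 2 * π ^ 2) := by positivity
  refine mul_le_mul_of_nonneg_left ?_ hπ
  rw [one_div_div]
  linarith

end Literature.NumberTheory.LFunctions.GaussianInt

end
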